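import Summits.Ventures.Crystal3D.Theorems.StickyWulffConstantNoReconstructionGainConfinedCertificate
import HarnessLib

/-!
# A close-packed substrate site carries at most three film contacts

HONEST FRAMING. Part of the venture `Summits/Ventures/Crystal3D` (cell `crystal3d-full`), helper for the crux
`NoReconstructionGain` (stmt-Ventures-19144, route `route-Ventures-StickyWulffConstant`), line
`replication-exactness` (inside `stub_noCriminal` = EXACT₀), lead wulff-p1 g21; memo
`HOME/wulff-p1/g21/VFLUX-g21.md` §2 (the SUBSTRATE side of the Voronoi flux calibration: a top-layer site `p` with
`a` film contacts satisfies `a ≤ 2√3·Φ(p)`, with equality only at `a = 3`, the rigid hollow triple).  This file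
lands the combinatorial shadow of that statement, dual to the tree's `fcc_offLattice_unitContacts_le_three` (an
off-lattice FILM ball has `≤ 3` lattice contacts):

* `card_film_contacts_le_three_basal` — over the close-packed layer `k` of `Λ₀` (`k√(2/3) ≤ s < (k+1)√(2/3)`,
  normal `e₃`), every substrate site is touched by AT MOST THREE balls of any film.  Proof (sum of squares, no
  angles): the `n` contact directions `u_q = q − p` are unit vectors with pairwise `⟪u_q, u_{q'}⟫ ≤ 1/2` (film balls
  are `≥ 1` apart) and heights `(u_q)₂ ≥ √(2/3)` (film balls lie at height `≥ (k+1)√(2/3)`, plugs lie IN layer `k`);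
  hence `(n√(2/3))² ≤ (Σ_q (u_q)₂)² ≤ ‖Σ_q u_q‖² ≤ n + n(n−1)/2`, i.e. `n ≤ 3`.

* `film_contacts_three_rigid_basal` — the equality case is RIGID: three film balls on one site lie exactly in the
  first adsorbed layer (height `(k+1)√(2/3)`) and touch pairwise (the hollow triple; all inequalities become equalities).

So `X(H, Q) ≤ 3 · #{sites touched}` on the basal face, with `3` only at hollow triples.  WHAT THIS IS NOT: nothing about
other faces or about the flux areas themselves; rung F-C1 not moved.
-/

noncomputable section

namespace Summit.Ventures.Crystal3D.Theorems

open Summit.Ventures.Crystal3D Finset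
open Literature.MathematicalPhysics.StatisticalMechanics (fccStacking)
open scoped InnerProductSpace

/-- The third coordinate is the `e₃`-component. -/
private theorem inner_e3_bsc (v : EuclideanSpace ℝ (Fin 3)) :
    ⟪v, EuclideanSpace.single 2 (1 : ℝ)⟫_ℝ = v 2 := by
  rw [EuclideanSpace.inner_single_right]; simp

/-- **A close-packed substrate site carries at most three film contacts.**  Over the layer `k` of `Λ₀`
(`k√(2/3) ≤ s < (k+1)√(2/3)`, normal `e₃`), for every film `Q` on `H(e₃, s)` and every site `p` of `H(e₃, s)`,
at most three balls of `Q` lie at distance exactly `1` from `p`. -/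
theorem card_film_contacts_le_three_basal (k : ℤ) {s : ℝ} (hs : (k : ℝ) * Real.sqrt (2 / 3) ≤ s)
    (hs' : s < ((k : ℝ) + 1) * Real.sqrt (2 / 3)) {Q : Finset (EuclideanSpace ℝ (Fin 3))}
    (hQ : IsFilmOn (EuclideanSpace.single 2 (1 : ℝ)) s Q) {p : EuclideanSpace ℝ (Fin 3)}
    (hp : p ∈ halfCrystal (EuclideanSpace.single 2 (1 : ℝ)) s) :
    (Q.filter fun q => dist q p = 1).card ≤ 3 := by
  classical
  set T := Q.filter fun q => dist q p = 1 with hT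
  set c : ℝ := Real.sqrt (2 / 3) with hc
  have hc2 : c ^ 2 = 2 / 3 := Real.sq_sqrt (by norm_num)
  have hcpos : 0 < c := Real.sqrt_pos.2 (by norm_num)
  -- contact directions
  set u : EuclideanSpace ℝ (Fin 3) → EuclideanSpace ℝ (Fin 3) := fun q => q - p with hu
  have hmemT : ∀ q ∈ T, q ∈ Q ∧ dist q p = 1 := fun q hq => by simpa [hT] using hq
  have hnorm : ∀ q ∈ T, ‖u q‖ = 1 := by
    intro q hq; rw [hu]; simp only; rw [← dist_eq_norm]; exact (hmemT q hq).2
  -- heights: `(u q)₂ ≥ c`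
  have hheight : ∀ q ∈ T, c ≤ (u q) 2 := by
    intro q hq
    obtain ⟨hqQ, hd⟩ := hmemT q hq
    have h1 := le_height_of_isFilmOn_basal k hs hQ hqQ
    have h2 := plug_apply_two_eq_basal k hs hs' hQ hqQ (p := p) ⟨hp, hd⟩
    have : (u q) 2 = q 2 - p 2 := by rw [hu]; simp
    rw [this, h2]; linarith
  -- pairwise inner products `≤ 1/2`, diagonal `= 1`
  have hinner : ∀ q ∈ T, ∀ q' ∈ T, ⟪u q, u q'⟫_ℝ ≤ if q = q' then 1 else 1 / 2 := by
    intro q hq q' hq'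
    split_ifs with hqq
    · subst hqq; rw [real_inner_self_eq_norm_sq, hnorm q hq]; norm_num
    · have hd : 1 ≤ dist q q' := hQ.1 q (hmemT q hq).1 q' (hmemT q' hq').1 hqq
      have hsub : u q - u q' = q - q' := by rw [hu]; simp only; abel
      have hdn : ‖u q - u q'‖ ^ 2 = ‖u q‖ ^ 2 - 2 * ⟪u q, u q'⟫_ℝ + ‖u q'‖ ^ 2 :=
        norm_sub_sq_real (u q) (u q')
      rw [hsub, ← dist_eq_norm, hnorm q hq, hnorm q' hq'] at hdn
      nlinarith [hd]
  -- the sum vector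
  set S : EuclideanSpace ℝ (Fin 3) := ∑ q ∈ T, u q with hS
  set n : ℕ := T.card with hn
  have hS2 : (n : ℝ) * c ≤ S 2 := by
    have : S 2 = ∑ q ∈ T, (u q) 2 := by rw [hS]; simp
    rw [this]
    calc (n : ℝ) * c = ∑ q ∈ T, c := by rw [Finset.sum_const, nsmul_eq_mul]
      _ ≤ ∑ q ∈ T, (u q) 2 := Finset.sum_le_sum hheight
  have hSnorm : S 2 ≤ ‖S‖ := by
    have h := real_inner_le_norm S (EuclideanSpace.single 2 (1 : ℝ))
    rw [inner_e3_bsc, PiLp.norm_single, norm_one, mul_one] at h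
    exact h
  have hSS : ‖S‖ ^ 2 ≤ (n : ℝ) + (n : ℝ) * ((n : ℝ) - 1) / 2 := by
    rw [← real_inner_self_eq_norm_sq, hS, sum_inner]
    simp_rw [inner_sum]
    have hrow : ∀ q ∈ T, ∑ q' ∈ T, ⟪u q, u q'⟫_ℝ ≤ 1 + ((n : ℝ) - 1) / 2 := by
      intro q hq
      calc ∑ q' ∈ T, ⟪u q, u q'⟫_ℝ ≤ ∑ q' ∈ T, (if q = q' then (1 : ℝ) else 1 / 2) :=
            Finset.sum_le_sum fun q' hq' => hinner q hq q' hq'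
        _ = 1 + ((n : ℝ) - 1) / 2 := by
            rw [Finset.sum_ite, Finset.sum_const, Finset.sum_const, nsmul_eq_mul, nsmul_eq_mul]
            have h1 : (T.filter fun q' => q = q').card = 1 := by
              rw [Finset.card_eq_one]
              refine ⟨q, ?_⟩
              ext x
              simp only [Finset.mem_filter, Finset.mem_singleton]
              constructor
              · rintro ⟨-, rfl⟩; rfl
              · rintro rfl; exact ⟨hq, rfl⟩
            have h2 : ((T.filter fun q' => ¬ q = q').card : ℝ) = (n : ℝ) - 1 := by
              have := Finset.card_filter_add_card_filter_not (s := T) (fun q' => q = q')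
              rw [h1, ← hn] at this
              have : (T.filter fun q' => ¬ q = q').card = n - 1 := by omega
              rw [this, Nat.cast_sub (by rw [hn]; exact Finset.card_pos.2 ⟨q, hq⟩), Nat.cast_one]
            rw [h1, h2]; ring
    calc ∑ q ∈ T, ∑ q' ∈ T, ⟪u q, u q'⟫_ℝ ≤ ∑ q ∈ T, (1 + ((n : ℝ) - 1) / 2) := Finset.sum_le_sum hrow
      _ = (n : ℝ) + (n : ℝ) * ((n : ℝ) - 1) / 2 := by rw [Finset.sum_const, nsmul_eq_mul, ← hn]; ring
  -- combine: (n c)² ≤ (S 2)² ≤ ‖S‖² ≤ n + n(n-1)/2, with c² = 2/3 ⇒ n ≤ 3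
  have hnc : 0 ≤ (n : ℝ) * c := mul_nonneg (Nat.cast_nonneg _) hcpos.le
  have h1 : ((n : ℝ) * c) ^ 2 ≤ ‖S‖ ^ 2 := by
    have := hS2.trans hSnorm
    exact pow_le_pow_left₀ hnc this 2
  have h2 : (n : ℝ) ^ 2 * (2 / 3) ≤ (n : ℝ) + (n : ℝ) * ((n : ℝ) - 1) / 2 := by
    have : ((n : ℝ) * c) ^ 2 = (n : ℝ) ^ 2 * c ^ 2 := by ring
    rw [this, hc2] at h1; exact h1.trans hSS
  have h3 : (n : ℝ) ≤ 3 := by nlinarith [h2, Nat.cast_nonneg (α := ℝ) n]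
  exact_mod_cast h3

set_option maxHeartbeats 400000 in
/-- **Rigidity of the extremal case.**  If a substrate site `p` (close-packed layer `k`, normal `e₃`) is touched by
EXACTLY three balls of a film, then the three balls lie exactly in the first adsorbed layer (height `(k+1)√(2/3)`)
and touch one another pairwise — the hollow triple.  (All inequalities of `card_film_contacts_le_three_basal` are
equalities at `n = 3`: `(3√(2/3))² = 6 = 3 + 3`.) -/
theorem film_contacts_three_rigid_basal (k : ℤ) {s : ℝ} (hs : (k : ℝ) * Real.sqrt (2 / 3) ≤ s)
    (hs' : s < ((k : ℝ) + 1) * Real.sqrt (2 / 3)) {Q : Finset (EuclideanSpace ℝ (Fin 3))}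
    (hQ : IsFilmOn (EuclideanSpace.single 2 (1 : ℝ)) s Q) {p : EuclideanSpace ℝ (Fin 3)}
    (hp : p ∈ halfCrystal (EuclideanSpace.single 2 (1 : ℝ)) s)
    (h3 : (Q.filter fun q => dist q p = 1).card = 3) :
    ∀ q ∈ Q.filter (fun q => dist q p = 1),
      q 2 = ((k : ℝ) + 1) * Real.sqrt (2 / 3) ∧
        ∀ q' ∈ Q.filter (fun q => dist q p = 1), q' ≠ q → dist q q' = 1 := by
  classical
  set c : ℝ := Real.sqrt (2 / 3) with hc
  have hc2 : c ^ 2 = 2 / 3 := Real.sq_sqrt (by norm_num)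
  have hcpos : 0 < c := Real.sqrt_pos.2 (by norm_num)
  obtain ⟨x, y, z, hxy, hxz, hyz, hT⟩ := Finset.card_eq_three.1 h3
  have hmem : ∀ q, q ∈ Q.filter (fun q => dist q p = 1) → q ∈ Q ∧ dist q p = 1 := fun q hq => by
    simpa using hq
  have hx := hmem x (by rw [hT]; simp)
  have hy := hmem y (by rw [hT]; simp)
  have hz := hmem z (by rw [hT]; simp)
  -- basic facts for a contact ball
  have hp2 : p 2 = (k : ℝ) * c := plug_apply_two_eq_basal k hs hs' hQ hx.1 (p := p) ⟨hp, hx.2⟩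
  have facts : ∀ q, q ∈ Q ∧ dist q p = 1 → ‖q - p‖ = 1 ∧ c ≤ q 2 - p 2 := by
    intro q hq
    refine ⟨by rw [← dist_eq_norm]; exact hq.2, ?_⟩
    have h1 := le_height_of_isFilmOn_basal k hs hQ hq.1
    rw [hp2]; linarith
  have pair : ∀ q q', q ∈ Q ∧ dist q p = 1 → q' ∈ Q ∧ dist q' p = 1 → q ≠ q' →
      ⟪q - p, q' - p⟫_ℝ ≤ 1 / 2 ∧ (⟪q - p, q' - p⟫_ℝ = 1 / 2 → dist q q' = 1) := by
    intro q q' hq hq' hne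
    have hd : 1 ≤ dist q q' := hQ.1 q hq.1 q' hq'.1 hne
    have hsub : (q - p) - (q' - p) = q - q' := by abel
    have hdn : ‖(q - p) - (q' - p)‖ ^ 2 = ‖q - p‖ ^ 2 - 2 * ⟪q - p, q' - p⟫_ℝ + ‖q' - p‖ ^ 2 :=
      norm_sub_sq_real _ _
    rw [hsub, ← dist_eq_norm, (facts q hq).1, (facts q' hq').1] at hdn
    refine ⟨by nlinarith [hd], fun h => ?_⟩
    rw [h] at hdn
    have hd2 : dist q q' ^ 2 = 1 := by linarith
    have hd0 : 0 ≤ dist q q' := dist_nonneg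
    nlinarith [hd2, hd0, hd]
  obtain ⟨nx, ax⟩ := facts x hx
  obtain ⟨ny, ay⟩ := facts y hy
  obtain ⟨nz, az⟩ := facts z hz
  obtain ⟨ixy, exy⟩ := pair x y hx hy hxy
  obtain ⟨ixz, exz⟩ := pair x z hx hz hxz
  obtain ⟨iyz, eyz⟩ := pair y z hy hz hyz
  -- the sum vector
  set S : EuclideanSpace ℝ (Fin 3) := (x - p) + (y - p) + (z - p) with hS
  have hS2 : S 2 = (x 2 - p 2) + (y 2 - p 2) + (z 2 - p 2) := by
    rw [hS]; simp only [PiLp.add_apply, PiLp.sub_apply]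
  have hSn : ‖S‖ ^ 2 = 3 + 2 * (⟪x - p, y - p⟫_ℝ + ⟪x - p, z - p⟫_ℝ + ⟪y - p, z - p⟫_ℝ) := by
    rw [hS, ← real_inner_self_eq_norm_sq]
    simp only [inner_add_left, inner_add_right, real_inner_self_eq_norm_sq, nx, ny, nz,
      real_inner_comm (y - p) (x - p), real_inner_comm (z - p) (x - p), real_inner_comm (z - p) (y - p)]
    ring
  have hle : S 2 ≤ ‖S‖ := by
    have h := real_inner_le_norm S (EuclideanSpace.single 2 (1 : ℝ))
    rw [inner_e3_bsc, PiLp.norm_single, norm_one, mul_one] at h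
    exact h
  have hsum_ge : 3 * c ≤ S 2 := by rw [hS2]; linarith
  have hsum0 : 0 ≤ S 2 := by nlinarith
  have hsq : (S 2) ^ 2 ≤ ‖S‖ ^ 2 := pow_le_pow_left₀ hsum0 hle 2
  -- all equalities
  have h9c : (3 * c) ^ 2 = 6 := by nlinarith [hc2]
  have hS2sq : 6 ≤ (S 2) ^ 2 := by
    rw [← h9c]; exact pow_le_pow_left₀ (by positivity) hsum_ge 2
  have hI : ⟪x - p, y - p⟫_ℝ + ⟪x - p, z - p⟫_ℝ + ⟪y - p, z - p⟫_ℝ = 3 / 2 := by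
    apply le_antisymm (by linarith)
    linarith [hsq, hSn, hS2sq]
  have hxy' : ⟪x - p, y - p⟫_ℝ = 1 / 2 := by linarith
  have hxz' : ⟪x - p, z - p⟫_ℝ = 1 / 2 := by linarith
  have hyz' : ⟪y - p, z - p⟫_ℝ = 1 / 2 := by linarith
  have hsum_le : S 2 ≤ 3 * c := by
    have h6 : ‖S‖ ^ 2 = 6 := by rw [hSn, hI]; norm_num
    have h9 : (S 2) ^ 2 ≤ (3 * c) ^ 2 := by rw [h9c]; linarith [hsq, h6]
    exact (pow_le_pow_iff_left₀ hsum0 (by positivity) (by norm_num : (2 : ℕ) ≠ 0)).1 h9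
  have hsum_le' : (x 2 - p 2) + (y 2 - p 2) + (z 2 - p 2) ≤ 3 * c := hS2 ▸ hsum_le
  have hxc : x 2 - p 2 = c := by linarith
  have hyc : y 2 - p 2 = c := by linarith
  have hzc : z 2 - p 2 = c := by linarith
  -- read off
  intro q hq
  rw [hT, Finset.mem_insert, Finset.mem_insert, Finset.mem_singleton] at hq
  have key : ∀ q, (q = x ∨ q = y ∨ q = z) → q 2 = ((k : ℝ) + 1) * c ∧
      ∀ q', (q' = x ∨ q' = y ∨ q' = z) → q' ≠ q → dist q q' = 1 := by
    intro q hq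
    constructor
    · rcases hq with rfl | rfl | rfl
      · linarith [hxc, hp2]
      · linarith [hyc, hp2]
      · linarith [hzc, hp2]
    · intro q' hq' hne
      rcases hq with rfl | rfl | rfl <;> rcases hq' with rfl | rfl | rfl
      all_goals first
        | exact absurd rfl hne
        | exact exy hxy'
        | exact exz hxz'
        | exact eyz hyz'
        | (rw [dist_comm]; first | exact exy hxy' | exact exz hxz' | exact eyz hyz')
  refine ⟨(key q hq).1, fun q' hq' hne => (key q hq).2 q' ?_ hne⟩
  rw [hT, Finset.mem_insert, Finset.mem_insert, Finset.mem_singleton] at hq'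
  exact hq'

end Summit.Ventures.Crystal3D.Theorems

end
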